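import Literature.MathematicalPhysics.QuantumFieldTheory.QCDPhaseQuenched
import Literature.MathematicalPhysics.QuantumLattice.WilsonPositivityDomain
import HarnessLib

/-!
# Crux `TorusHalfSpectrum` (stmt-QuantumFields-9508), line `registered` (`Lines/birth.lean`, reshape v3) —
# stub `stub_det_diracMatrix_pos`: the `N_f`-flavour Wilson determinant is positive for positive bare masses

Stub D of the birth skeleton of the crux
`Summit.QuantumFields.QCD.Theses.QuarksNoInfraredClause.TorusHalfSpectrum`: for every `SU(3)` gauge field `U`
on the periodic four-torus of side `S`, every flavour number `N_f` and every bare-mass tuple with all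
`m_f > 0` (hopping parameters `κ_f = 1/(2 m_f + 8) < 1/8`, Seiler's positivity domain), the determinant of
the flavour-diagonal Wilson–Dirac matrix `diracMatrix U mq` has strictly positive real part (it is real by
`γ₅`-hermiticity, `det_diracMatrix_im`).  This is the constant-sign input that turns configuration-wise
bounds on fermionic integrals into bounds on the honest ratio `qcdTorusExpect` in the heavy-mass corner
(stub H, `stub_conjugate_heavy`, consumes it as a hypothesis).

Proof: the determinant factorises over flavours (`det_diracMatrix`,
`det D(U) = ∏_f det D_W(U, m_f, 1)`); each one-flavour factor is the real number `Re det D_W(U, m_f, 1)`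
(`fermionDet_wilsonDirac_eq_ofReal_of_mass_pos`, `γ₅`-hermiticity) and is strictly positive for
`m_f > 0` by the tree's Seiler positivity theorem `fermionDet_wilsonDirac_re_pos`
(`Literature/MathematicalPhysics/QuantumLattice/WilsonPositivityDomain.lean`: homotopy in the hopping
strength `t ↦ 1 − (t/(m+4)) Σ_μ W_μ`, kernel-free since `‖Σ_μ W_μ‖ ≤ 4 < m + 4`, real determinant,
`= 1` at `t = 0`, intermediate value theorem); a finite product of positive reals is positive.
Everything used is proved in the tree (no named fact).  Sources: Montvay–Münster, *Quantum Fields on a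
Lattice* (1994) §4.2 (4.35), §5.1.2 (5.16); Seiler, LNP 159 (1982), apud Rothe, *Lattice Gauge Theories*
(2005) Ch. 12 ("for `κ < 1/8` … `0 < det K[U]`").
-/

noncomputable section

namespace Summit.QuantumFields.QCD.Cruxes.TorusHalfSpectrum.Birth.DetDiracMatrixPos

open Literature.MathematicalPhysics.QuantumFieldTheory Literature.MathematicalPhysics.QuantumLattice

/-- **Stub `stub_det_diracMatrix_pos` of the birth skeleton of `TorusHalfSpectrum` (= `DetPosStmt`)**:
for every `SU(3)` gauge field on the periodic four-torus of side `S` and every bare-mass tuple with all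
`m_f > 0`, `0 < Re det (diracMatrix U mq)` — the `N_f`-flavour Wilson fermion determinant has constant
(positive) sign on the whole configuration space.  Flavour factorisation `det_diracMatrix`, reality of each
one-flavour factor `fermionDet_wilsonDirac_eq_ofReal_of_mass_pos`, Seiler positivity
`fermionDet_wilsonDirac_re_pos` (`κ_f < 1/8`), and `Finset.prod_pos`. -/
theorem stub_det_diracMatrix_pos :
    ∀ (Nf S : ℕ) [NeZero S] (U : GaugeConfig 4 S (Matrix.specialUnitaryGroup (Fin 3) ℂ))
      (mq : Fin Nf → ℝ), (∀ f, 0 < mq f) → 0 < ((diracMatrix U mq).det).re := by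
  intro Nf S _ U mq hmq
  have hf : ∀ f, fermionDet (wilsonDirac (fundamentalRep (Fin 3)) U (mq f) 1) =
      (((fermionDet (wilsonDirac (fundamentalRep (Fin 3)) U (mq f) 1)).re : ℝ) : ℂ) := fun f =>
    fermionDet_wilsonDirac_eq_ofReal_of_mass_pos _ fundamentalRep_mem_unitaryGroup U (mq f)
  rw [det_diracMatrix, Finset.prod_congr rfl fun f _ => hf f, ← Complex.ofReal_prod,
    Complex.ofReal_re]
  exact Finset.prod_pos fun f _ =>
    fermionDet_wilsonDirac_re_pos _ fundamentalRep_mem_unitaryGroup U (hmq f)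

end Summit.QuantumFields.QCD.Cruxes.TorusHalfSpectrum.Birth.DetDiracMatrixPos

end
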